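import Summits.Ventures.Crystal3D.Theorems.StickyWulffConstantGenericWallFloorBarlowRowStart
import Summits.Ventures.Crystal3D.Theorems.StickyWulffConstantTextureLiminfBarlowSampleBonds
import HarnessLib

/-!
# Row F4, bottom plate: the ROW walker family of a Barlow plate's «++» c-layers delivers every input of
# `walkerFamilies_card_le_payers` (crux `GenericWallFloor`, stmt-Ventures-19480, line `WallLedgerG`; lane T's row corner, (xxxvii⁗))

HONEST FRAMING. Venture `Summits/Ventures/Crystal3D` (cell `crystal3d-full`), helper `--supports` the crux `GenericWallFloor`
(stmt-Ventures-19480) of `route-Ventures-StickyWulffConstant`, registered line `WallLedgerG`, open stub `stub_twoSlabAdhesion`.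
Rung credit only; F-C1 not moved; NOT the stub, not yet the row count.

Row analogue of `bottomFamily_spec` (`…BarlowBottomFamily`, the zigzag family).  The bottom plate
`P₁ = stacking L₁ s₀ σ₁ ∩ [−2R₀, −R₀] × {lat ≤ ρ}`; the ROW direction `r = α u + β v` (a slot with `r₂ = 0`) with `L₁ r`
`e₃`-steep (lane T's `RowSteep`: `√2/2 ≤ layerRise`); the family: CROSSING sites `pᵢ = barlowPos σ₁ (mi i) (ai i) (bi i)` of
«++» c-LAYERS (`σ₁ (mi i) = 1 = σ₁ (mi i − 1)` — the only layers whose balls certify in-layer walkers, p639545) at height `≥ H`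
whose row-predecessors `pᵢ − r` lie strictly below `H` (`−2R₀+2 ≤ H ≤ −R₀−3`), pairwise distinct, lateral radius `≤ ρin`.
Steering = `e₃` (no W1 hypothesis for rows).  Conclusion, per member: `WalkInv`, `StackWF`, bottom entry `⟨L₁, r, 0⟩`, strong
certificate, fuel, end ∈ `PAY = {deg ≠ 12, −R₀−2 ≤ y₂ ≤ h+R₀+2}`, end ∈ grain 1's ROW REACH SET
`reachSet L₁ (L₁(haggLabel σ₁ 0 • b) + s₀) M` with the ROW FRAME SET `M = insert (twinFrame L₁ (L₁ e₃)) (chainFrames e₃ L₁ r)`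
(forced chain frames with the basal mirror adjoined, so that every plate site is in ONE reach set; written out, no new `def`); and injectivity of `walkRun X e₃ N` on the family.
Mechanism: `barlow_cc_full` + `rowStart_valid` (validity), `rowFamily_walkRun_injOn` (injectivity), `walkEnd_mem_PAY_barlow` with the
off-registry hypothesis `hoff` (NOT HIGH), and NOT LOW by SEALING: an end below `−R₀ − 2` would be a plate site with all twelve
neighbours present (`stacking_sealing_below`, `barlowWindow_complete`, `ncard_touching_stacking_eq_twelve`), not a ball of `≤ 11` contacts.
* `mem_rowFrames_of_stack`, `barlow_mem_reachSet_row`; `twelve_le_card_contacts_of_complete_site`;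
  **`rowBottomFamily_spec`**.
WHAT THIS IS NOT: the top-plate mirror and the three corner counts are the next files; F-C1 not moved.
-/

noncomputable section

namespace Summit.Ventures.Crystal3D.Theorems

open Finset
open Literature.MathematicalPhysics.StatisticalMechanics
open Summit.Ventures.Crystal3D.Cruxes.TextureLiminf.TexShadow (stacking)
open scoped InnerProductSpace

variable {X : Finset (EuclideanSpace ℝ (Fin 3))}

/-! ### The row reach frames -/

/-- Frames of sound well-formed stacks over `⟨L, r, 0⟩` are row frames. -/
theorem mem_rowFrames_of_stack {z : EuclideanSpace ℝ (Fin 3)} {L : EuclideanSpace ℝ (Fin 3) ≃ₗᵢ[ℝ] EuclideanSpace ℝ (Fin 3)}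
    {r : EuclideanSpace ℝ (Fin 3)} :
    ∀ stk : List WalkEntry, StackSound z stk → StackWF z stk → stk.getLast? = some ⟨L, r, 0⟩ →
      ∀ e ∈ stk, e.frame ∈ insert (twinFrame L (L (EuclideanSpace.single (2 : Fin 3) (1 : ℝ)))) (chainFrames z L r) :=
  fun _ hS hW hl e he => Set.mem_insert_of_mem _ (frame_mem_chainFrames_of_stack hS hW hl e he)

/-- Every plate site lies in the row reach set. -/
theorem barlow_mem_reachSet_row (z : EuclideanSpace ℝ (Fin 3)) (L : EuclideanSpace ℝ (Fin 3) ≃ₗᵢ[ℝ] EuclideanSpace ℝ (Fin 3))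
    (s₀ r : EuclideanSpace ℝ (Fin 3)) {σ : ℤ → ℤ} (hσ : IsHaggSeq σ) (k i j : ℤ) :
    L (barlowPos 1 (Real.sqrt (2 / 3)) σ k i j) + s₀ ∈
      reachSet L (L ((haggLabel σ 0 : ℝ) • barlowOffset 1) + s₀) (insert (twinFrame L (L (EuclideanSpace.single (2 : Fin 3) (1 : ℝ)))) (chainFrames z L r)) :=
  barlow_mem_reachSet L s₀ hσ (Set.mem_insert_of_mem _ (self_mem_chainFrames z L r)) (Set.mem_insert _ _) k i j

/-! ### A complete site has twelve contacts -/

/-- **A plate site all of whose touching sites are occupied has at least twelve contacts.** -/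
theorem twelve_le_card_contacts_of_complete_site {σ : ℤ → ℤ} (hσ : IsHaggSeq σ)
    (L : EuclideanSpace ℝ (Fin 3) ≃ₗᵢ[ℝ] EuclideanSpace ℝ (Fin 3)) (s₀ : EuclideanSpace ℝ (Fin 3)) (m a b : ℤ)
    (hcomp : ∀ q ∈ barlowStacking 1 (Real.sqrt (2 / 3)) σ, dist q (barlowPos 1 (Real.sqrt (2 / 3)) σ m a b) ≤ 1 → L q + s₀ ∈ X) :
    12 ≤ (X.filter fun q => dist (L (barlowPos 1 (Real.sqrt (2 / 3)) σ m a b) + s₀) q = 1).card := by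
  classical
  set y := L (barlowPos 1 (Real.sqrt (2 / 3)) σ m a b) + s₀ with hy
  have hyS : y ∈ stacking L s₀ σ := ⟨_, barlowPos_mem m a b, rfl⟩
  have h12 := ncard_touching_stacking_eq_twelve (L := L) (s := s₀) hσ hyS
  have hsub : {w | w ∈ stacking L s₀ σ ∧ dist y w = 1} ⊆ ↑(X.filter fun q => dist y q = 1) := by
    rintro w ⟨⟨q, hq, rfl⟩, hd⟩
    rw [Finset.coe_filter]
    refine ⟨hcomp q hq ?_, hd⟩
    have : dist y (L q + s₀) = dist (barlowPos 1 (Real.sqrt (2 / 3)) σ m a b) q := by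
      rw [hy, dist_add_right, L.dist_map]
    rw [dist_comm, ← this]; exact hd.le
  have := Set.ncard_le_ncard hsub (Finset.finite_toSet _)
  rw [h12, Set.ncard_coe_finset] at this
  exact this

section Cell

variable (σ₁ : ℤ → ℤ) (L₁ : EuclideanSpace ℝ (Fin 3) ≃ₗᵢ[ℝ] EuclideanSpace ℝ (Fin 3)) (s₀ : EuclideanSpace ℝ (Fin 3))

open scoped Classical in
/-- **The bottom ROW family delivers every input of the two-family count.**  See the module docstring. -/
theorem rowBottomFamily_spec (hσ₁ : IsHaggSeq σ₁) (hX : ∀ p ∈ X, ∀ q ∈ X, p ≠ q → 1 ≤ dist p q)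
    {sE : EuclideanSpace ℝ (Fin 3)} (hsE : sE ∈ fccSlots) (hcert : ExactOnly 0 (fccSlots.filter fun w => 0 < ⟪w, sE⟫_ℝ))
    -- the cell
    {σ₂ : ℤ → ℤ} (hσ₂ : IsHaggSeq σ₂) (L₂ : EuclideanSpace ℝ (Fin 3) ≃ₗᵢ[ℝ] EuclideanSpace ℝ (Fin 3)) (s₂ : EuclideanSpace ℝ (Fin 3))
    (R₀ h ρ : ℝ) (hR₀ : 6 ≤ R₀) (hh : 0 ≤ h) (hρ : 1 ≤ ρ) (P₁ P₂ : Finset (EuclideanSpace ℝ (Fin 3))) (hP₁X : P₁ ⊆ X) (hP₂X : P₂ ⊆ X)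
    (hcell : ∀ p ∈ X, -(2 * R₀) ≤ p 2 ∧ p 2 ≤ h + 2 * R₀ ∧ p 0 ^ 2 + p 1 ^ 2 ≤ ρ ^ 2)
    (hP₁ : ∀ p, p ∈ P₁ ↔ (p ∈ stacking L₁ s₀ σ₁ ∧ -(2 * R₀) ≤ p 2 ∧ p 2 ≤ -R₀ ∧ p 0 ^ 2 + p 1 ^ 2 ≤ ρ ^ 2))
    (hP₂ : ∀ p, p ∈ P₂ ↔ (p ∈ stacking L₂ s₂ σ₂ ∧ h + R₀ ≤ p 2 ∧ p 2 ≤ h + 2 * R₀ ∧ p 0 ^ 2 + p 1 ^ 2 ≤ ρ ^ 2))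
    -- the row data
    {r : EuclideanSpace ℝ (Fin 3)} (hr : r ∈ fccSlots) (α β : ℤ)
    (hrαβ : r = (α : ℝ) • triangularVec₁ 1 + (β : ℝ) • triangularVec₂ 1)
    (hsteep : Real.sqrt 2 / 2 ≤ ⟪L₁ r, EuclideanSpace.single (2 : Fin 3) (1 : ℝ)⟫_ℝ)
    -- off-registry
    (hoff : ∀ y ∈ reachSet L₁ (L₁ ((haggLabel σ₁ 0 : ℝ) • barlowOffset 1) + s₀)
      (insert (twinFrame L₁ (L₁ (EuclideanSpace.single (2 : Fin 3) (1 : ℝ)))) (chainFrames (EuclideanSpace.single (2 : Fin 3) (1 : ℝ)) L₁ r)), y ∉ stacking L₂ s₂ σ₂)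
    -- the family
    (H ρin : ℝ) (hHlo : -(2 * R₀) + 2 ≤ H) (hHhi : H ≤ -R₀ - 3)
    (hρin : ρin + 8 / 3 * (h + 4 * R₀) + 2 ≤ ρ - 1)
    {ι : Type*} (T : Finset ι) (mi ai bi : ι → ℤ)
    (hcc : ∀ i ∈ T, σ₁ (mi i) = 1 ∧ σ₁ (mi i - 1) = 1)
    (hlow : ∀ i ∈ T, H ≤ ⟪L₁ (barlowPos 1 (Real.sqrt (2 / 3)) σ₁ (mi i) (ai i) (bi i)) + s₀, EuclideanSpace.single (2 : Fin 3) (1 : ℝ)⟫_ℝ)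
    (hpred : ∀ i ∈ T, ⟪L₁ (barlowPos 1 (Real.sqrt (2 / 3)) σ₁ (mi i) (ai i - α) (bi i - β)) + s₀,
      EuclideanSpace.single (2 : Fin 3) (1 : ℝ)⟫_ℝ < H)
    (hinjT : ∀ i ∈ T, ∀ j ∈ T,
      barlowPos 1 (Real.sqrt (2 / 3)) σ₁ (mi i) (ai i) (bi i) = barlowPos 1 (Real.sqrt (2 / 3)) σ₁ (mi j) (ai j) (bi j) → i = j)
    (hlat : ∀ i ∈ T, Real.sqrt ((L₁ (barlowPos 1 (Real.sqrt (2 / 3)) σ₁ (mi i) (ai i) (bi i)) + s₀) 0 ^ 2 +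
      (L₁ (barlowPos 1 (Real.sqrt (2 / 3)) σ₁ (mi i) (ai i) (bi i)) + s₀) 1 ^ 2) ≤ ρin)
    -- fuel
    {N : ℕ} (hN2 : 8 * (h + 4 * R₀) < 3 * (N : ℝ)) :
    (∀ i ∈ T,
      WalkInv X (EuclideanSpace.single (2 : Fin 3) (1 : ℝ))
          (L₁ (barlowPos 1 (Real.sqrt (2 / 3)) σ₁ (mi i) (ai i) (bi i)) + s₀, [⟨L₁, r, 0⟩]) ∧
      StackWF (EuclideanSpace.single (2 : Fin 3) (1 : ℝ)) ([⟨L₁, r, 0⟩] : List WalkEntry) ∧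
      ([⟨L₁, r, 0⟩] : List WalkEntry).getLast? = some ⟨L₁, r, 0⟩ ∧
      (∃ e rest, ([⟨L₁, r, 0⟩] : List WalkEntry) = e :: rest ∧
        WalkCertified12 X (L₁ (barlowPos 1 (Real.sqrt (2 / 3)) σ₁ (mi i) (ai i) (bi i)) + s₀) e) ∧
      8 * (h + 2 * R₀ - ⟪L₁ (barlowPos 1 (Real.sqrt (2 / 3)) σ₁ (mi i) (ai i) (bi i)) + s₀,
        EuclideanSpace.single (2 : Fin 3) (1 : ℝ)⟫_ℝ) < 3 * N ∧
      (walkRun X (EuclideanSpace.single (2 : Fin 3) (1 : ℝ)) N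
          (L₁ (barlowPos 1 (Real.sqrt (2 / 3)) σ₁ (mi i) (ai i) (bi i)) + s₀, [⟨L₁, r, 0⟩])).1 ∈
        X.filter (fun y => (X.filter fun q => dist y q = 1).card ≠ 12 ∧ -R₀ - 2 ≤ y 2 ∧ y 2 ≤ h + R₀ + 2) ∧
      (walkRun X (EuclideanSpace.single (2 : Fin 3) (1 : ℝ)) N
          (L₁ (barlowPos 1 (Real.sqrt (2 / 3)) σ₁ (mi i) (ai i) (bi i)) + s₀, [⟨L₁, r, 0⟩])).1 ∈
        reachSet L₁ (L₁ ((haggLabel σ₁ 0 : ℝ) • barlowOffset 1) + s₀) (insert (twinFrame L₁ (L₁ (EuclideanSpace.single (2 : Fin 3) (1 : ℝ)))) (chainFrames (EuclideanSpace.single (2 : Fin 3) (1 : ℝ)) L₁ r))) ∧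
    (∀ i ∈ T, ∀ j ∈ T,
      walkRun X (EuclideanSpace.single (2 : Fin 3) (1 : ℝ)) N
          (L₁ (barlowPos 1 (Real.sqrt (2 / 3)) σ₁ (mi i) (ai i) (bi i)) + s₀, [⟨L₁, r, 0⟩]) =
        walkRun X (EuclideanSpace.single (2 : Fin 3) (1 : ℝ)) N
          (L₁ (barlowPos 1 (Real.sqrt (2 / 3)) σ₁ (mi j) (ai j) (bi j)) + s₀, [⟨L₁, r, 0⟩]) → i = j) := by
  set e₃ : EuclideanSpace ℝ (Fin 3) := EuclideanSpace.single (2 : Fin 3) (1 : ℝ) with he₃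
  have he₃n : ‖e₃‖ = 1 := by rw [he₃, PiLp.norm_single, norm_one]
  have he₃i : ∀ d : EuclideanSpace ℝ (Fin 3), ⟪d, e₃⟫_ℝ = d 2 := fun d => by
    rw [he₃, EuclideanSpace.inner_single_right]; simp
  set bp : ℤ → ℤ → ℤ → EuclideanSpace ℝ (Fin 3) := fun m a b => barlowPos 1 (Real.sqrt (2 / 3)) σ₁ m a b with hbp
  have hLr : ‖L₁ r‖ = 1 := by rw [LinearIsometryEquiv.norm_map, norm_eq_one_of_mem_fccSlots hr]
  have hLr2 : (L₁ r) 2 ≤ 1 := by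
    have h1 := abs_apply_sub_le_dist (L₁ r) 0 2
    rw [dist_zero_right, hLr] at h1
    have : (0 : EuclideanSpace ℝ (Fin 3)) 2 = 0 := rfl
    rw [this, sub_zero] at h1
    exact (abs_le.1 h1).2
  -- the predecessor of each start: `q i + r = p i`
  have hqp : ∀ i, bp (mi i) (ai i - α) (bi i - β) + r = bp (mi i) (ai i) (bi i) := by
    intro i
    show barlowPos 1 (Real.sqrt (2 / 3)) σ₁ (mi i) (ai i - α) (bi i - β) + r = barlowPos 1 (Real.sqrt (2 / 3)) σ₁ (mi i) (ai i) (bi i)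
    rw [hrαβ, barlowPos_add_inplane, sub_add_cancel, sub_add_cancel]
  have hqeq : ∀ i, bp (mi i) (ai i) (bi i) - r = bp (mi i) (ai i - α) (bi i - β) := fun i => by
    rw [← hqp i, add_sub_cancel_right]
  -- heights and lateral radius of the predecessor
  have hq2 : ∀ i, (L₁ (bp (mi i) (ai i - α) (bi i - β)) + s₀) 2 = (L₁ (bp (mi i) (ai i) (bi i)) + s₀) 2 - (L₁ r) 2 := by
    intro i; rw [← hqp i, map_add]; simp; ring
  -- the predecessor is deep, hence full
  have hfullpred : ∀ i ∈ T, L₁ (bp (mi i) (ai i - α) (bi i - β)) + s₀ ∈ X ∧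
      ∀ w ∈ fccSlots, L₁ (bp (mi i) (ai i - α) (bi i - β)) + s₀ + L₁ w ∈ X := by
    intro i hi
    have hph : (L₁ (bp (mi i) (ai i - α) (bi i - β)) + s₀) 2 < H := by rw [← he₃i]; exact hpred i hi
    have hpl : H - 1 ≤ (L₁ (bp (mi i) (ai i - α) (bi i - β)) + s₀) 2 := by
      rw [hq2 i]; have := hlow i hi; rw [he₃i] at this; linarith
    have hplat : Real.sqrt ((L₁ (bp (mi i) (ai i - α) (bi i - β)) + s₀) 0 ^ 2 +
        (L₁ (bp (mi i) (ai i - α) (bi i - β)) + s₀) 1 ^ 2) ≤ ρin + 1 := by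
      have h1 := sqrt_lateral_add_le (L₁ (bp (mi i) (ai i) (bi i)) + s₀) (-(L₁ r))
      have e : L₁ (bp (mi i) (ai i) (bi i)) + s₀ + -L₁ r = L₁ (bp (mi i) (ai i - α) (bi i - β)) + s₀ := by
        rw [← hqp i, map_add]; abel
      rw [e, norm_neg, hLr] at h1
      have := hlat i hi; linarith
    refine barlow_cc_full σ₁ L₁ s₀ (mi i) (ai i - α) (bi i - β) (hcc i hi).1 (hcc i hi).2
      (barlowWindow_complete L₁ s₀ R₀ ρ hρ P₁ hP₁X hP₁ (mi i) (ai i - α) (bi i - β) (by linarith) (by linarith) ?_)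
    have h0 : 0 ≤ (L₁ (bp (mi i) (ai i - α) (bi i - β)) + s₀) 0 ^ 2 + (L₁ (bp (mi i) (ai i - α) (bi i - β)) + s₀) 1 ^ 2 := by
      positivity
    have hrr : Real.sqrt ((L₁ (bp (mi i) (ai i - α) (bi i - β)) + s₀) 0 ^ 2 +
        (L₁ (bp (mi i) (ai i - α) (bi i - β)) + s₀) 1 ^ 2) ≤ ρ - 1 := by
      have : 0 ≤ 8 / 3 * (h + 4 * R₀) := by positivity
      linarith
    have h7 := pow_le_pow_left₀ (Real.sqrt_nonneg _) hrr 2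
    rwa [Real.sq_sqrt h0] at h7
  -- validity of every start
  have hvalid : ∀ i ∈ T, WalkInv X e₃ (L₁ (bp (mi i) (ai i) (bi i)) + s₀, [⟨L₁, r, 0⟩]) ∧
      StackWF e₃ ([⟨L₁, r, 0⟩] : List WalkEntry) ∧ ([⟨L₁, r, 0⟩] : List WalkEntry).getLast? = some ⟨L₁, r, 0⟩ ∧
      WalkCertified12 X (L₁ (bp (mi i) (ai i) (bi i)) + s₀) ⟨L₁, r, 0⟩ := fun i hi =>
    rowStart_valid L₁ s₀ hr hsteep (hqp i) (hfullpred i hi).1 (hfullpred i hi).2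
  -- injectivity
  have hinj := rowFamily_walkRun_injOn hX hsE hcert he₃n L₁ s₀ hr hsteep T (fun i => bp (mi i) (ai i) (bi i))
    (fun i hi => by simp only [hqeq i]; exact hfullpred i hi) H hlow
    (fun i hi => by simp only [hqeq i]; exact hpred i hi) hinjT N
  refine ⟨fun i hi => ?_, hinj⟩
  obtain ⟨hI, hW, hlast, hC⟩ := hvalid i hi
  have hstartX : L₁ (bp (mi i) (ai i) (bi i)) + s₀ ∈ X := hI.1
  have hstart2 : H ≤ (L₁ (bp (mi i) (ai i) (bi i)) + s₀) 2 := by rw [← he₃i]; exact hlow i hi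
  have hfuel : 8 * (h + 2 * R₀ - ⟪L₁ (bp (mi i) (ai i) (bi i)) + s₀, e₃⟫_ℝ) < 3 * N := by
    rw [he₃i]; linarith
  -- reach set of the start, frames of the family
  have hreach : L₁ (bp (mi i) (ai i) (bi i)) + s₀ ∈
      reachSet L₁ (L₁ ((haggLabel σ₁ 0 : ℝ) • barlowOffset 1) + s₀) (insert (twinFrame L₁ (L₁ e₃)) (chainFrames e₃ L₁ r)) :=
    barlow_mem_reachSet_row e₃ L₁ s₀ r hσ₁ (mi i) (ai i) (bi i)
  have hM₁ : ∀ stk : List WalkEntry, StackSound e₃ stk → StackWF e₃ stk → stk.getLast? = some ⟨L₁, r, 0⟩ →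
      ∀ e ∈ stk, e.frame ∈ insert (twinFrame L₁ (L₁ e₃)) (chainFrames e₃ L₁ r) := mem_rowFrames_of_stack
  have hlat' : Real.sqrt ((L₁ (bp (mi i) (ai i) (bi i)) + s₀) 0 ^ 2 + (L₁ (bp (mi i) (ai i) (bi i)) + s₀) 1 ^ 2) +
      8 / 3 * (h + 4 * R₀) ≤ ρ - 1 := by have := hlat i hi; linarith
  -- the end: not high (reach set off the top stacking), lateral radius, `≤ 11` contacts
  obtain ⟨hyX, hydeg, hylat, -⟩ := walkEnd_not_high_barlow hX hsE hcert hσ₂ L₁ L₂ (L₁ ((haggLabel σ₁ 0 : ℝ) • barlowOffset 1) + s₀)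
    s₂ R₀ h ρ hρ P₂ hP₂X hcell hP₂ (insert (twinFrame L₁ (L₁ e₃)) (chainFrames e₃ L₁ r)) hM₁ hoff (s := (L₁ (bp (mi i) (ai i) (bi i)) + s₀, [⟨L₁, r, 0⟩]))
    hI hW hlast hreach hlat' hfuel
  -- NOT LOW by sealing: below `−R₀ − 2` the end would be a plate site with twelve neighbours
  have hmono := walkRun_height_ge hX hsE hcert he₃n N (L₁ (bp (mi i) (ai i) (bi i)) + s₀, [⟨L₁, r, 0⟩]) hI
  simp only at hmono
  rw [he₃i, he₃i] at hmono
  set y := (walkRun X e₃ N (L₁ (bp (mi i) (ai i) (bi i)) + s₀, [⟨L₁, r, 0⟩])).1 with hy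
  have hlow' : -R₀ - 2 ≤ y 2 := by
    by_contra hlt
    push Not at hlt
    -- `y` is a plate ball
    have hyP : y ∈ P₁ := by
      by_contra hyP
      exact stacking_sealing_below hσ₁ L₁ s₀ (-(2 * R₀)) (-R₀) ρ hρ X P₁ hX hP₁X hP₁ y hyX hyP (hcell y hyX).1
        (by linarith) hylat
    obtain ⟨⟨y', hy'S, hyy'⟩, -, -, -⟩ := (hP₁ y).1 hyP
    obtain ⟨m, a, b, rfl⟩ := hy'S
    have hyy : L₁ (barlowPos 1 (Real.sqrt (2 / 3)) σ₁ m a b) + s₀ = y := hyy'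
    -- all its touching sites are occupied
    have hcomp := barlowWindow_complete L₁ s₀ R₀ ρ hρ P₁ hP₁X hP₁ m a b (by rw [hyy]; linarith) (by rw [hyy]; linarith)
      (by rw [hyy]; exact hylat)
    have h12 := twelve_le_card_contacts_of_complete_site hσ₁ L₁ s₀ m a b hcomp
    rw [hyy] at h12
    omega
  have hPAY : y ∈ X.filter (fun y => (X.filter fun q => dist y q = 1).card ≠ 12 ∧ -R₀ - 2 ≤ y 2 ∧ y 2 ≤ h + R₀ + 2) :=
    walkEnd_mem_PAY_barlow hX hsE hcert hσ₂ L₁ L₂ (L₁ ((haggLabel σ₁ 0 : ℝ) • barlowOffset 1) + s₀) s₂ R₀ h ρ hρ P₂ hP₂X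
      hcell hP₂ (insert (twinFrame L₁ (L₁ e₃)) (chainFrames e₃ L₁ r)) hM₁ hoff hI hW hlast hreach hlat' hfuel hlow'
  have hendreach := walkRun_fst_mem_reachSet hX hsE hcert he₃n hM₁ N _ hI hW hlast hreach
  exact ⟨hI, hW, hlast, ⟨⟨L₁, r, 0⟩, [], rfl, hC⟩, hfuel, hPAY, hendreach⟩

end Cell

end Summit.Ventures.Crystal3D.Theorems

end
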